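import Summits.BirchSwinnertonDyer.BirchSwinnertonDyer.Theorems.ThetaPartnerAtTwoSignedMainConjectureCMTwoRankZeroFlatTwistMinusHecke
import Summits.BirchSwinnertonDyer.BirchSwinnertonDyer.Theorems.ThetaPartnerAtTwoSignedMainConjectureCMTwoRankZeroFlatTwistSquarefree
import Literature.NumberTheory.EllipticCurves.CuspFormTwistRatPlusSymbolOdd
import HarnessLib

/-!
# Route `ThetaPartnerAtTwo`, crux K2r0P `SignedMainConjectureCMTwoRankZeroOfPub` (stmt-BirchSwinnertonDyer-24945),
# line `rankzero` v14, stub (μ♭)_A: NEGATIVE (imaginary) prime quadratic twists, part 1 — Birch's lemma with its period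
# constant for `d < 0`, and the plus/minus symbol congruence `2([x]⁺_{f_A} − [0]⁺_{f_A}) ≡ ∑_{t∈S} 2[tx]⁻_{f_W} (mod 2)`
# GRANTED a displayed minus-period unit at the base curve

Cell `bsd-wall`, width seat `bsd-wall-tp2-p2-w3` (g2). THEOREMS ONLY (no `def`, no named fact, no `sorry`); helper `--supports`
the crux; sequel of `…FlatTwistMinusHecke` and of the real-twist files `…FlatTwist*`. BSD is not proved by any of this.

For `d < 0` square-free, `d ≡ 1 (mod 4)`, `(d, N_W) = 1`, and `A` a globally minimal model of `W^{(d)}`, the character `(·/|d|)`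
is ODD and Birch's lemma reads the PLUS symbols of `f_A` on the MINUS symbols of `f_W`
(`exists_rat_forall_ratPlusSymbol_charTwist_eq_of_odd`: `c·Ω⁺_{f_A}·g(χ) = i·Ω⁻_{f_W}`, and `g(χ)² = −|d|`).

* §1 `gaussSum_stdAddChar_sq_of_isQuadratic_of_odd` (`g(χ)² = −N` for an odd quadratic primitive `χ` mod `N`, by Fourier
  inversion on `ℤ/N`); **`exists_ratPlusSymbol_negTwist_eq_sum_and_sq`** — `[x]⁺_{f_A} = c·∑_b (b/|d|)[x + b/|d|]⁻_{f_W}` with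
  `c²·|d|·(Ω⁺_{f_A})² = (Ω⁻_{f_W})²` as soon as some `[x]⁺_{f_A} ≠ 0`.
* §2 `norm_birchConst_eq_one_of_neg` — `|c|₂ = 1` from the period unit `h2` AT `A` (`Ω(A) = u_A Ω⁺_{f_A}`), Pal 2012 for
  `d < 0` (`Ω(A)√|d| = c_∞(A)·|Ω⁻(W)|`, tree theorem, `c_∞(A) = 1` since `Δ(A) < 0`) and the DISPLAYED minus-period unit at
  `W`: `|Ω⁻(W)| = ϖ·Ω⁻_{f_W}` with `|ϖ|₂ = 1` — the `p = 2` minus twin of the PUB fact `realPeriodRat_eq_unit_mul_plusPeriod_two`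
  (at odd `p` it is the tree theorem `SkinnerUrban2014.…exists_unit_mul_minusPeriod_of_irreducible`; at `p = 2` for
  `Δ < 0`, odd Manin constant and odd isogeny degrees it is expected but NOT in the tree, hence a hypothesis here).
* §3 **`exists_plusMinus_congruence_negTwist`** — with `W` good at `2`, `2 ∣ a₂(W)`, `Δ(W) < 0`, `|d|` PRIME: a non-empty odd set
  `S ⊆ {1, |d|, d²}` with `2([b/4^k]⁺_{f_A} − [0]⁺_{f_A}) − ∑_{t∈S} 2[tb/4^k]⁻_{f_W} ∈ 2ℤ` for all `k ≥ 1`, `b` odd.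
The sequel `…FlatTwistImaginarySibling` moves the residual FLAT certificate between two negative twists of the same `W`.

References: B. Mazur, J. Tate, J. Teitelbaum, Invent. Math. 84 (1986) §I.8 [MazurTateTeitelbaum1986Invent]; V. Pal, Proc. AMS
140 (2012) Thm. 3.2 (case d < 0), p. 1514 [Pal2012]; G. Shimura (1971) Prop. 3.64 [Shimura1971]; R. Greenberg, V. Vatsal,
Invent. Math. 142 (2000) §3 Rem. 3.4 [GreenbergVatsal2000]; K. Ireland, M. Rosen, GTM 84, Prop. 8.2.2 [IrelandRosen1990].
-/

set_option autoImplicit false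
-- the Theorems namespace of this sub repeats the summit name by design (D-0017 nested layout)
set_option linter.dupNamespace false

noncomputable section

open scoped Classical MatrixGroups ModularForm NumberField NumberTheorySymbols

open NumberField IsDedekindDomain Rat.HeightOneSpectrum CongruenceSubgroup
  Literature.NumberTheory.EllipticCurves Literature.NumberTheory.GaloisRepresentations
  WeierstrassCurve Literature.NumberTheory.EllipticCurves.ModularForms Literature.NumberTheory.EllipticCurves.Rank1Residual
  Literature.NumberTheory.EllipticCurves.Rank1Residual.Typed
  Summit.BirchSwinnertonDyer.Rank1Residual Summit.BirchSwinnertonDyer.Rank1Residual.Supersingular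

namespace Summit.BirchSwinnertonDyer.BirchSwinnertonDyer.Theorems.FlatTwist.Imaginary

/-! ## §1. Birch's lemma with its period constant for a NEGATIVE square-free twist -/

section Birch

/-- **`g(χ)² = −N` for an ODD quadratic primitive Dirichlet character mod `N`** (any `N ≥ 1`): `𝓕χ = χ⁻¹(−·)·g(χ) = −g(χ)·χ`
and Fourier inversion `𝓕𝓕χ = N·χ(−·) = −N·χ` at `1`. [cite: IrelandRosen1990, Prop. 8.2.2] -/
theorem gaussSum_stdAddChar_sq_of_isQuadratic_of_odd {N : ℕ} [NeZero N] {χ : DirichletCharacter ℂ N}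
    (hχ : χ.IsPrimitive) (hq : MulChar.IsQuadratic χ) (ho : χ.Odd) :
    gaussSum χ (ZMod.stdAddChar (N := N)) ^ 2 = -(N : ℂ) := by
  have ho' : ∀ k : ZMod N, χ (-k) = -χ k := fun k ↦ by
    rw [← neg_one_mul, map_mul, ho, neg_one_mul]
  have h1 : ZMod.dft (⇑χ) = fun k ↦ χ k * (-gaussSum χ (ZMod.stdAddChar (N := N))) := by
    funext k
    rw [hχ.fourierTransform_eq_inv_mul_gaussSum, hq.inv, ho']
    ring
  have h2 := ZMod.dft_dft (⇑χ)
  rw [h1, ZMod.dft_mul_const, h1] at h2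
  have h3 := congrFun h2 1
  simp only [ho', map_one, one_mul, smul_eq_mul, mul_neg, mul_one, neg_mul, neg_neg] at h3
  rw [sq]
  linear_combination h3

variable (W : WeierstrassCurve ℚ) [W.IsElliptic] {d : ℤ} {A : WeierstrassCurve ℚ} [A.IsElliptic]
  [NeZero (W.conductorNorm ℤ)] [NeZero (A.conductorNorm ℤ)] [NeZero d.natAbs]
  {fW : CuspForm (Gamma0 (W.conductorNorm ℤ)) 2} {fA : CuspForm (Gamma0 (A.conductorNorm ℤ)) 2}

/-- **Birch's lemma for `(f_W, f_A)`, `A = W^{(d)}` with `d < 0`, WITH the period constant.** For `d < 0`, `d ≡ 1 (mod 4)`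
square-free, `(d, N_W) = 1`, `A` a model of `W^{(d)}` and the newforms `f_W`, `f_A`: ONE `c ∈ ℚ` with
`[x]⁺_{f_A} = c · ∑_{b mod |d|} (b/|d|) · [x + b/|d|]⁻_{f_W}` for every `x` (MINUS symbols of `f_W`), and, as soon as some
`[x]⁺_{f_A} ≠ 0`, `c² · |d| · (Ω⁺_{f_A})² = (Ω⁻_{f_W})²` (`c·Ω⁺_{f_A}·g(χ) = iΩ⁻_{f_W}`, `g(χ)² = −|d|`).
[cite: MazurTateTeitelbaum1986Invent, §I.8] [cite: Shimura1971, Prop. 3.64] -/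
theorem exists_ratPlusSymbol_negTwist_eq_sum_and_sq (hmod : exists_isNewformOf) (hd : d < 0) (hd4 : d % 4 = 1)
    (hsq : Squarefree d) (hcop : IsCoprime d (W.conductorNorm ℤ : ℤ)) {C : VariableChange ℚ}
    (hA : C • W.quadraticTwist (d : ℚ) = A) (hfW : IsNewformOf W fW) (hfA : IsNewformOf A fA)
    {χ : MulChar (ZMod d.natAbs) ℤ} (hχ : ∀ a : ZMod d.natAbs, χ a = J((a.val : ℤ) | d.natAbs)) :
    ∃ c : ℚ, (∀ x : ℚ, ratPlusSymbol fA x =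
        c * ∑ b : ZMod d.natAbs, (J((b.val : ℤ) | d.natAbs) : ℚ) * ratMinusSymbol fW (x + (b.val : ℚ) / d.natAbs)) ∧
      ((∃ x : ℚ, ratPlusSymbol fA x ≠ 0) → (c : ℝ) ^ 2 * (d.natAbs : ℝ) * plusPeriod fA ^ 2 = minusPeriod fW ^ 2) := by
  have hmd : (d.natAbs : ℤ) = -d := Int.ofNat_natAbs_of_nonpos hd.le
  have hodd : Odd d.natAbs := Int.natAbs_odd.mpr (Int.odd_iff.mpr (by omega))
  have hsq' : Squarefree d.natAbs := Int.squarefree_natAbs.mpr hsq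
  have hm4 : d.natAbs % 4 = 3 := by omega
  obtain ⟨hq, hprim⟩ := mulChar_jacobi_complex_isQuadratic_isPrimitive hχ hodd hsq'
  have hχodd : DirichletCharacter.Odd (χ.ringHomComp (Int.castRingHom ℂ)) := by
    show (χ.ringHomComp (Int.castRingHom ℂ)) (-1) = -1
    have h := mulChar_jacobi_apply_intCast hχ (-1)
    rw [Int.cast_neg, Int.cast_one] at h
    rw [MulChar.ringHomComp_apply, h, jacobiSym.at_neg_one hodd, ZMod.χ₄_nat_three_mod_four hm4]
    simp
  have hg2 := gaussSum_stdAddChar_sq_of_isQuadratic_of_odd hprim hq hχodd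
  have hNA := conductorNorm_twist_eq W hmod hd4 hsq hcop hA
  have hN : W.conductorNorm ℤ ∣ A.conductorNorm ℤ := ⟨d.natAbs ^ 2, hNA⟩
  have hm : d.natAbs ^ 2 ∣ A.conductorNorm ℤ := ⟨W.conductorNorm ℤ, by rw [hNA, mul_comm]⟩
  have hFA := isNewformOf_twist_eq_charTwist W hd4 hsq hcop hA hfW hfA hχ hq hprim hN hm
  subst hFA
  obtain ⟨c, hc, hper⟩ := exists_rat_forall_ratPlusSymbol_charTwist_eq_of_odd (A.conductorNorm ℤ) hN hm hq hχodd hprim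
    hfW.1 hfW.coeffField_eq_bot hfA.1 hfA.coeffField_eq_bot (fun u ↦ J((u.val : ℤ) | d.natAbs))
    (fun u ↦ by rw [MulChar.ringHomComp_apply, hχ, eq_intCast])
  have hsum : ∀ x : ℚ, ∑ b : ZMod d.natAbs, (J((b.val : ℤ) | d.natAbs) : ℚ) * ratMinusSymbol fW (x + (b.val : ℚ) / d.natAbs) =
      ∑ u : ZMod d.natAbs, (J((u.val : ℤ) | d.natAbs) : ℚ) * ratMinusSymbol fW (x + twistShift u) := fun x ↦ rfl
  refine ⟨c, fun x ↦ by rw [hc x, hsum x], fun ⟨x, hx⟩ ↦ ?_⟩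
  have hS : ∃ r : ℚ, ∑ u : ZMod d.natAbs, (J((u.val : ℤ) | d.natAbs) : ℚ) * ratMinusSymbol fW (r + twistShift u) ≠ 0 := by
    refine ⟨x, fun h0 ↦ hx ?_⟩
    rw [hc x, h0, mul_zero]
  have hP := hper hS
  have hsqP := congrArg (fun z : ℂ ↦ z ^ 2) hP
  rw [mul_pow, mul_pow, hg2, mul_pow, Complex.I_sq] at hsqP
  apply Complex.ofReal_injective
  push_cast
  linear_combination -hsqP

end Birch

/-! ## §2. The period constant is a `2`-adic unit, granted the displayed minus-period unit at `W` -/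

section PeriodUnit

/-- **`|c|₂ = 1` for a negative twist**: from `c²·m·(Ω⁺_A)² = (Ω⁻_W)²`, `Ω(A) = u_A·Ω⁺_A` (`|u_A|₂ = 1`), `Ω(A)·√m = Ω⁻(W)` (Pal, one real
component) and the displayed `Ω⁻(W) = ϖ·Ω⁻_W` (`|ϖ|₂ = 1`). [cite: Pal2012, Thm. 3.2 (case d < 0)] [cite: GreenbergVatsal2000, §3 Rem. 3.4] -/
theorem norm_birchConst_eq_one_of_neg {c uA ϖ : ℚ} {m : ℕ} (hm : 0 < m) {ΩA ΩmW PA PmW : ℝ} (hPA : 0 < PA)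
    (hper : (c : ℝ) ^ 2 * (m : ℝ) * PA ^ 2 = PmW ^ 2) (hA : ΩA = (uA : ℝ) * PA)
    (hPal : ΩA * Real.sqrt (m : ℝ) = ΩmW) (hϖ : ΩmW = (ϖ : ℝ) * PmW)
    (huA : ‖(uA : ℚ_[2])‖ = 1) (hϖ1 : ‖(ϖ : ℚ_[2])‖ = 1) : ‖(c : ℚ_[2])‖ = 1 := by
  have hmR : (0 : ℝ) < m := by exact_mod_cast hm
  have hϖ0 : (ϖ : ℝ) ≠ 0 := by
    have h : ϖ ≠ 0 := by rintro rfl; simp at hϖ1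
    exact_mod_cast h
  -- `Ω⁻_W = Ω(A)√m/ϖ = u_A P_A √m/ϖ`
  have hPmW : PmW = (uA : ℝ) * PA * Real.sqrt (m : ℝ) / ϖ := by
    rw [← hA, hPal, hϖ]; field_simp
  have hsq : ((c * ϖ : ℚ) : ℝ) ^ 2 = ((uA : ℚ) : ℝ) ^ 2 := by
    rw [hPmW, div_pow, mul_pow, mul_pow, Real.sq_sqrt hmR.le] at hper
    have hne : (m : ℝ) * PA ^ 2 ≠ 0 := by positivity
    push_cast
    field_simp at hper
    nlinarith [hper, hne, sq_nonneg PA, sq_nonneg (ϖ : ℝ)]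
  have hsqQ : (c * ϖ) ^ 2 = uA ^ 2 := by exact_mod_cast hsq
  have hn : ‖((c * ϖ : ℚ) : ℚ_[2])‖ ^ 2 = ‖((uA : ℚ) : ℚ_[2])‖ ^ 2 := by
    rw [← norm_pow, ← norm_pow]
    congr 1
    exact_mod_cast congrArg (fun q : ℚ ↦ ((q : ℚ) : ℚ_[2])) hsqQ
  push_cast at hn
  rw [norm_mul, hϖ1, huA, mul_one] at hn
  nlinarith [hn, norm_nonneg ((c : ℚ) : ℚ_[2])]

end PeriodUnit

/-! ## §3. The plus/minus congruence for a negative prime twist -/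

section Congruence

variable (W : WeierstrassCurve ℚ) [W.IsElliptic] [W.IsGloballyMinimal] {d : ℤ} {A : WeierstrassCurve ℚ}
  [A.IsElliptic] [A.IsGloballyMinimal] [NeZero (W.conductorNorm ℤ)] [NeZero (A.conductorNorm ℤ)]
  {fW : CuspForm (Gamma0 (W.conductorNorm ℤ)) 2} {fA : CuspForm (Gamma0 (A.conductorNorm ℤ)) 2}

omit [W.IsElliptic] [W.IsGloballyMinimal] [A.IsElliptic] [A.IsGloballyMinimal] [NeZero (W.conductorNorm ℤ)]
  [NeZero (A.conductorNorm ℤ)] in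
/-- Any model `A = C • W^{(d)}` of a quadratic twist by `d ≠ 0` of a curve with `Δ(W) < 0` has `Δ(A) < 0`, hence ONE real
component. [cite: Pal2012, p. 1514] -/
theorem numRealComponents_twistModel_eq_one (hΔ : W.Δ < 0) (hd0 : d ≠ 0) {C : VariableChange ℚ}
    (hA : C • W.quadraticTwist (d : ℚ) = A) : (A.baseChange ℝ).numRealComponents = 1 := by
  have hΔA : A.Δ < 0 := by
    rw [← hA, variableChange_Δ, quadraticTwist_Δ]
    have hu : (0 : ℚ) < (C.u⁻¹ : ℚˣ) ^ 12 := by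
      have : ((C.u⁻¹ : ℚˣ) : ℚ) ≠ 0 := Units.ne_zero _
      positivity
    have hd6 : (0 : ℚ) < (d : ℚ) ^ 6 := by
      have : (d : ℚ) ≠ 0 := by exact_mod_cast hd0
      positivity
    nlinarith [mul_pos hu hd6, hΔ, mul_pos (mul_pos hu hd6) (neg_pos.mpr hΔ)]
  rw [numRealComponents_baseChange_real, if_neg (not_lt.mpr hΔA.le)]

/-- **THE PLUS/MINUS CONGRUENCE FOR A NEGATIVE PRIME TWIST.** Let `W/ℚ` be globally minimal, good at `2` with `2 ∣ a₂(W)`,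
`Δ(W) < 0`; `d < 0` with `|d|` PRIME, `d ≡ 1 (mod 4)`, `(d, N_W) = 1`; `A` a globally minimal model of `W^{(d)}`; `f_W`, `f_A`
newforms; some `[x]⁺_{f_A} ≠ 0`. Grant modularity (`hmod`), the period unit at `2` (`h2`, used at `A`) and the DISPLAYED
minus-period unit at `W` (`|Ω⁻(W)| = ϖ·Ω⁻_{f_W}`, `|ϖ|₂ = 1`). THEN there is a non-empty odd `S ⊆ {1, |d|, d²}` with, for all
`k ≥ 1`, `b` odd: `2([b/4^k]⁺_{f_A} − [0]⁺_{f_A}) − ∑_{t∈S} 2[tb/4^k]⁻_{f_W} ∈ 2ℤ`.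
[cite: MazurTateTeitelbaum1986Invent, §I.4 (4.2) and §I.8] [cite: Pal2012, Thm. 3.2 (case d < 0)] [cite: Shimura1971, Prop. 3.64] -/
theorem exists_plusMinus_congruence_negTwist (hmod : exists_isNewformOf)
    (h2 : Literature.NumberTheory.EllipticCurves.realPeriodRat_eq_unit_mul_plusPeriod_two)
    (hss : GoodSS W 2) (hΔ : W.Δ < 0) (hd : d < 0) (hd4 : d % 4 = 1) (hp : d.natAbs.Prime)
    (hcop : IsCoprime d (W.conductorNorm ℤ : ℤ)) {C : VariableChange ℚ} (hA : C • W.quadraticTwist (d : ℚ) = A)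
    (hfW : IsNewformOf W fW) (hfA : IsNewformOf A fA) (hnz : ∃ x : ℚ, ratPlusSymbol fA x ≠ 0)
    {ϖ : ℚ} (hϖ1 : ‖(ϖ : ℚ_[2])‖ = 1) (hϖ : W.imaginaryPeriodRat = (ϖ : ℝ) * minusPeriod fW) :
    ∃ S : Finset ℕ, S.Nonempty ∧ (∀ t ∈ S, Odd t) ∧
      ∀ k : ℕ, 1 ≤ k → ∀ b : ℤ, Odd b → ∃ z : ℤ,
        2 * (ratPlusSymbol fA ((b : ℚ) / 4 ^ k) - ratPlusSymbol fA 0) -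
          ∑ t ∈ S, 2 * ratMinusSymbol fW ((((t : ℤ) * b : ℤ) : ℚ) / 4 ^ k) = 2 * z := by
  haveI : Fact (Nat.Prime 2) := ⟨Nat.prime_two⟩
  set m : ℕ := d.natAbs with hm_def
  haveI : NeZero m := ⟨hp.ne_zero⟩
  haveI : Fact m.Prime := ⟨hp⟩
  have hd0 : d ≠ 0 := hd.ne
  have hsq : Squarefree d := Int.squarefree_natAbs.mp hp.squarefree
  have hmodd : Odd m := Int.natAbs_odd.mpr (Int.odd_iff.mpr (by omega))
  -- Birch (odd) with its period constant
  obtain ⟨χ, hχ⟩ := exists_mulChar_int_eq_jacobiSym m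
  obtain ⟨c, hc, hcsq⟩ := exists_ratPlusSymbol_negTwist_eq_sum_and_sq W hmod hd hd4 hsq hcop hA hfW hfA hχ
  -- reduction data
  have h2d : ¬ (2 : ℤ) ∣ d := by omega
  obtain ⟨hgoodA, haA⟩ := hasGoodReductionAtPrime_twist_and_frobeniusTrace_eq W 2 hmod hd4 hsq hcop hA hss.1 h2d
  have hssA : GoodSS A 2 := ⟨hgoodA, by rw [haA]; exact dvd_mul_of_dvd_right hss.2 _⟩
  have hmN : ¬ m ∣ W.conductorNorm ℤ := FlatTwist.not_natAbs_dvd_conductorNorm W hp hcop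
  have hgoodm : W.HasGoodReductionAtPrime m := by
    by_contra h
    exact hmN ((W.dvd_conductorNorm_iff_not_hasGoodReductionAtPrime m).mpr h)
  set a : ℤ := W.frobeniusTrace m with ha_def
  have haW : cuspCoeff fW m = (a : ℂ) := cuspCoeff_eq_frobeniusTrace_of_isNewformOf_holds hfW hgoodm
  have h2NW : ¬ 2 ∣ W.conductorNorm ℤ := not_dvd_level_of_isNewformOf hfW hss.1
  have h2NA : ¬ 2 ∣ A.conductorNorm ℤ := not_dvd_level_of_isNewformOf hfA hgoodA
  have hrealW : ∀ n, (cuspCoeff fW n).im = 0 := cuspCoeff_im_eq_zero_of_coeffField_eq_bot hfW.coeffField_eq_bot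
  have hrealA : ∀ n, (cuspCoeff fA n).im = 0 := cuspCoeff_im_eq_zero_of_coeffField_eq_bot hfA.coeffField_eq_bot
  -- the minus dilation set of the prime `m` for `f_W`
  obtain ⟨S, hS, hSd, hQS⟩ := exists_dilationSetMinus_prime fW hfW.1 hfW.coeffField_eq_bot hp hmN haW
  -- `|c|₂ = 1`: `h2` at `A`, Pal for `d < 0`, one real component, the displayed minus unit at `W`
  obtain ⟨uA, huA1, huA⟩ := h2 A hssA.1 (P2.irr_two_of_goodSS_two A hssA) fA hfA
  have hV : ∀ v : HeightOneSpectrum (𝓞 ℚ), ((primesEquiv v : ℕ) : ℤ) ∣ d →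
      W.HasGoodReductionAt v ∨ W.HasMultiplicativeReductionAt v := by
    intro v hvd
    left
    refine hasGoodReductionAt_of_not_dvd_conductorNorm W v fun hvN ↦ ?_
    have hℓ : ((primesEquiv v : ℕ)).Prime := (primesEquiv v).2
    have hu := Int.isUnit_iff_natAbs_eq.mp (hcop.isUnit_of_dvd' hvd (Int.natCast_dvd_natCast.mpr hvN))
    rw [Int.natAbs_natCast] at hu
    exact hℓ.one_lt.ne' hu
  have hPal := W.realPeriodRat_mul_sqrt_eq_of_twist_of_neg_of_squarefree hd hd4 hsq hV A C hA
  rw [numRealComponents_twistModel_eq_one W hΔ hd0 hA, Nat.cast_one, one_mul] at hPal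
  have hmZ : ((m : ℕ) : ℤ) = -d := Int.ofNat_natAbs_of_nonpos hd.le
  have hmR' : (m : ℝ) = -(d : ℝ) := by exact_mod_cast hmZ
  have hmR : Real.sqrt (-(d : ℝ)) = Real.sqrt (m : ℝ) := by rw [hmR']
  rw [hmR] at hPal
  have hcu : ‖(c : ℚ_[2])‖ = 1 :=
    norm_birchConst_eq_one_of_neg hp.pos (IsNewform0.plusPeriod_pos_holds hfA.1 hfA.coeffField_eq_bot)
      (hcsq hnz) huA hPal hϖ huA1 hϖ1
  refine ⟨S, hS, fun t ht ↦ (hmodd.pow (n := 2)).of_dvd_nat (hSd t ht), ?_⟩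
  intro k hk b hb
  set x : ℚ := (b : ℚ) / 4 ^ k with hx_def
  have h4pow : ((4 : ℚ) ^ k) = 2 ^ (2 * k) := by rw [pow_mul]; norm_num
  have hxW : x.den.Coprime (W.conductorNorm ℤ) := by
    rw [hx_def, h4pow]; exact SignedMuAtTwo.coprime_den_div_two_pow h2NW b (2 * k)
  have hxA : x.den.Coprime (A.conductorNorm ℤ) := by
    rw [hx_def, h4pow]; exact SignedMuAtTwo.coprime_den_div_two_pow h2NA b (2 * k)
  obtain ⟨z₁, hz₁⟩ := hQS x hxW
  choose i hi using fun t : ℕ ↦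
    exists_two_mul_ratMinusSymbol_eq_intCast fW hrealW (coprime_den_natCast_mul hxW t)
  obtain ⟨mA, hmA⟩ := SignedMuAtTwo.exists_two_mul_ratPlusSymbol_sub_eq_intCast fA hrealA hxA
  have hMA : (mA : ℚ) = c * ((∑ t ∈ S, i t : ℤ) + 2 * z₁) := by
    have hx1 := hc x
    have hx0 := hc 0
    simp only [zero_add] at hx0
    have hsumI : (∑ t ∈ S, 2 * ratMinusSymbol fW ((t : ℚ) * x)) = ((∑ t ∈ S, i t : ℤ) : ℚ) := by
      push_cast
      exact Finset.sum_congr rfl fun t _ ↦ hi t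
    have h2 : 2 * (c * ∑ u : ZMod m, (J((u.val : ℤ) | m) : ℚ) * ratMinusSymbol fW (x + (u.val : ℚ) / m) -
        c * ∑ u : ZMod m, (J((u.val : ℤ) | m) : ℚ) * ratMinusSymbol fW ((u.val : ℚ) / m)) =
        c * ∑ u : ZMod m, (J((u.val : ℤ) | m) : ℚ) *
          (2 * ratMinusSymbol fW (x + (u.val : ℚ) / m) - 2 * ratMinusSymbol fW ((u.val : ℚ) / m)) := by
      rw [← mul_sub, ← Finset.sum_sub_distrib, Finset.mul_sum, Finset.mul_sum, Finset.mul_sum]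
      exact Finset.sum_congr rfl fun u _ ↦ by ring
    rw [← hmA, hx1, hx0, h2, hz₁, hsumI]
  obtain ⟨z₂, hz₂⟩ := FlatTwist.exists_sub_eq_two_mul_of_eq_unit_mul (J := (∑ t ∈ S, i t) + 2 * z₁) hcu
    (by rw [hMA]; push_cast; ring)
  refine ⟨z₂ + z₁, ?_⟩
  have hsum : ∑ t ∈ S, 2 * ratMinusSymbol fW ((((t : ℤ) * b : ℤ) : ℚ) / 4 ^ k) = ((∑ t ∈ S, i t : ℤ) : ℚ) := by
    push_cast
    refine Finset.sum_congr rfl fun t _ ↦ ?_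
    rw [← hi t, hx_def]
    ring_nf
  rw [hsum, hmA]
  have hz₂' : (mA : ℚ) - ((∑ t ∈ S, i t : ℤ) + 2 * z₁ : ℤ) = 2 * z₂ := by exact_mod_cast hz₂
  push_cast at hz₂' ⊢
  linear_combination hz₂'

end Congruence

end Summit.BirchSwinnertonDyer.BirchSwinnertonDyer.Theorems.FlatTwist.Imaginary

end
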